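/-
Width seat `ym-line-cbag-p1-w3` (prover-ym-line-cbag-p1-w3-g8-0; own items stmt-QuantumFields-22254 `BoxFloorAllGroups` /
stmt-QuantumFields-22893 `ExpChartPackage2` CLOSED proved), helping LINE 3 `route-QuantumFields-SixPlaneColdBox`
(crux stmt-QuantumFields-25709 `DensityTransferG`): the Dirichlet plane kernels between the centre and its translate by `T e₀` are
`O(T⁻⁴ + H⁻⁴)` for ALL plane pairs (planner's input (b): «the Dirichlet plane-kernel bounds `|K_D(q,q';T)| ≤ c·T^{−4}`»).
-/
import Summits.QuantumFields.YangMills.Theorems.WeakCouplingRatesBulkDominatesColdBoxWDirKernelDiagFlat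
import Summits.QuantumFields.YangMills.Theorems.WeakCouplingRatesBoxDecay
import Summits.QuantumFields.YangMills.Theorems.WeakCouplingRatesEventuallyPow

/-!
# LINE 3 `SixPlaneColdBox`, glue: the temporal-gauge Dirichlet kernel between two plaquettes at separation `T e₀`, ANY two planes, is
# `≤ K₁/T⁴ + K₂/H⁴`

For crux `DensityTransferG` (the DLR transfer of the six-plane box covariance) the Gaussian value of the kernel covariance of the costs of
`q = (c_H; i<j)` and `q' = (c_H + Te₀; k<l)` is `(D/2)·C_D(q,q')² + 2β·(Σ_c F̄_c(q)F̄_c(q'))·C_D(q,q')` (`kernelCovSharpPairsG`); both the Wick term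
and the datum cross term need the SIZE of the Dirichlet kernel `C_D(q,q') = boxDirProjKernel H q q'` for all 36 plane pairs — `+T⁻⁴/π²` for equal
spatial planes, `−T⁻⁴/π²` for equal temporal planes, `O(T⁻⁵)` for distinct planes in the free continuum picture; what the transfer uses is the
uniform upper bound.  The tree has the two ingredients for every plane: the Dirichlet-vs-`ℤ⁴` comparison near the centre
(`exists_boxDirProjKernel_sub_curl_bound`: `|C_D(p,q) − (d₁div₂ g_q)(p)| ≤ K/H⁴`, `H ≥ 32`, `p, q` within `H/8` of the centre) and the decay of the
`ℤ⁴` curl kernel (`exists_curl_greenTensor_bound`: `|(d₁div₂ g_q)(y;k,l)| ≤ K_Z/‖y − x_q‖⁴` for `‖y − x_q‖ ≥ 3`).  Hence: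

* **`abs_boxDirProjKernel_le_of_near_centre`** — there are `K₁, K₂ ≥ 0` with `|C_D((x;i,j),(y;k,l))| ≤ K₁/‖x−y‖⁴ + K₂/H⁴` for `H ≥ 32`,
  `x, y` within `H/8` of the centre, `‖x − y‖ ≥ 3`, all planes;
* **`abs_boxDirProjKernel_centre_pair_le`** — for all `H ≥ 32`, `3 ≤ T`, `8T ≤ H` and all planes `i<j`, `k<l`:
  `|C_D((c_H;i,j),(c_H+Te₀;k,l))| ≤ K₁/T⁴ + K₂/H⁴` and the same for the swapped pair;
* **`abs_boxDirProjKernel_centre_pair_le_rpow`** — along the family `H = ⌈β^θ⌉`, `T = ⌈β^A⌉`, `0 < A ≤ θ`: eventually in `β`,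
  `|C_D| ≤ (K₁ + K₂)·β^{−4A}` for every plane pair (both orders).

No sorry; no new definition; standard axioms.  NOT a claim about the Yang–Mills mass gap: a statement about a finite-dimensional Gaussian kernel,
glue for a LINE onto the RECORD-type node `LatticeNonFreezing`.
-/

set_option autoImplicit false

noncomputable section

open Finset Real Filter Topology
open Literature.Probability.LatticeModels (Site)
open Literature.MathematicalPhysics.QuantumLattice
open Literature.MathematicalPhysics.QuantumFieldTheory
open Literature.MathematicalPhysics.QuantumFieldTheory.LatticeMaxwell
open Literature.MathematicalPhysics.QuantumFieldTheory.AxialGauge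

namespace Summit.QuantumFields.YangMills.Theorems.WeakCouplingRates

/-- The sup-distance between the centre and its translate by `T e₀` is `T`. -/
theorem norm_boxCentre_sub_translate (H T : ℕ) :
    ‖(boxCentre H : Site 4) - (boxCentre H + Pi.single 0 (T : ℤ))‖ = T := by
  rw [sub_add_cancel_left, norm_neg, Pi.norm_single, Int.norm_natCast]

/-- The sup-distance between the translate by `T e₀` and the centre is `T`. -/
theorem norm_translate_sub_boxCentre (H T : ℕ) :
    ‖(boxCentre H + Pi.single 0 (T : ℤ) : Site 4) - boxCentre H‖ = T := by
  rw [add_sub_cancel_left, Pi.norm_single, Int.norm_natCast]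

/-- **The Dirichlet kernel between two near-centre plaquettes at sup-distance `≥ 3` is `O(dist⁻⁴ + H⁻⁴)`, every pair of planes.**  There
are `K₁, K₂ ≥ 0` such that for `H ≥ 32`, base points `x, y` within `H/8` of the centre with `‖x − y‖ ≥ 3` and all planes `i<j`, `k<l`:
`|boxDirProjKernel H (x;i,j) (y;k,l)| ≤ K₁/‖x − y‖⁴ + K₂/H⁴` (Dirichlet-vs-`ℤ⁴` comparison + decay of the `ℤ⁴` curl kernel). -/
theorem abs_boxDirProjKernel_le_of_near_centre : ∃ K₁ K₂ : ℝ, 0 ≤ K₁ ∧ 0 ≤ K₂ ∧ ∀ (H : ℕ), (32 : ℝ) ≤ H →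
    ∀ (x y : Site 4) (i j k l : Fin 4), i < j → k < l →
      ‖x - boxCentre H‖ ≤ (H : ℝ) / 8 → ‖y - boxCentre H‖ ≤ (H : ℝ) / 8 → 3 ≤ ‖x - y‖ →
      |boxDirProjKernel H (x, i, j) (y, k, l)| ≤ K₁ / ‖x - y‖ ^ 4 + K₂ / (H : ℝ) ^ 4 := by
  obtain ⟨K_Z, hKZ0, hKZ⟩ := exists_curl_greenTensor_bound
  obtain ⟨K, hK0, hK⟩ := exists_boxDirProjKernel_sub_curl_bound
  refine ⟨K_Z, K, hKZ0, hK0, fun H hH x y i j k l hij hkl hx hy hxy => ?_⟩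
  have h1 := hK H hH (x, i, j) (y, k, l) hij hkl hx hy
  have h2 := hKZ ((y, k, l) : Plaq 4) x i j hxy
  simp only at h1 h2
  have h3 := abs_sub_abs_le_abs_sub (boxDirProjKernel H (x, i, j) (y, k, l))
    (LatticeForm.d₁ (LatticeChain.div₂ (greenTensor ((y, k, l) : Plaq 4))) x i j)
  linarith

/-- **The Dirichlet kernel between the centre plaquettes and their `T e₀`-translates is `O(T⁻⁴ + H⁻⁴)`, every pair of planes.**  With the
constants `K₁, K₂` of `abs_boxDirProjKernel_le_of_near_centre`, for `H ≥ 32`, `3 ≤ T`, `8T ≤ H` and all planes `i<j`, `k<l`: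
`|boxDirProjKernel H (c_H;i,j) (c_H+Te₀;k,l)| ≤ K₁/T⁴ + K₂/H⁴` and `|boxDirProjKernel H (c_H+Te₀;k,l) (c_H;i,j)| ≤ K₁/T⁴ + K₂/H⁴`. -/
theorem abs_boxDirProjKernel_centre_pair_le : ∃ K₁ K₂ : ℝ, 0 ≤ K₁ ∧ 0 ≤ K₂ ∧ ∀ (H : ℕ), (32 : ℝ) ≤ H → ∀ (T : ℕ), 3 ≤ T → 8 * T ≤ H →
    ∀ (i j k l : Fin 4), i < j → k < l →
      |boxDirProjKernel H (boxCentre H, i, j) (boxCentre H + Pi.single 0 (T : ℤ), k, l)| ≤ K₁ / (T : ℝ) ^ 4 + K₂ / (H : ℝ) ^ 4 ∧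
      |boxDirProjKernel H (boxCentre H + Pi.single 0 (T : ℤ), k, l) (boxCentre H, i, j)| ≤ K₁ / (T : ℝ) ^ 4 + K₂ / (H : ℝ) ^ 4 := by
  obtain ⟨K₁, K₂, hK₁, hK₂, hK⟩ := abs_boxDirProjKernel_le_of_near_centre
  refine ⟨K₁, K₂, hK₁, hK₂, fun H hH T hT3 h8T i j k l hij hkl => ?_⟩
  have h8Tr : (8 : ℝ) * T ≤ H := by exact_mod_cast h8T
  have hT3r : (3 : ℝ) ≤ T := by exact_mod_cast hT3
  set x : Site 4 := boxCentre H with hxdef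
  set y : Site 4 := boxCentre H + Pi.single 0 (T : ℤ) with hydef
  have hxy : ‖x - y‖ = T := by rw [hxdef, hydef]; exact norm_boxCentre_sub_translate H T
  have hyx : ‖y - x‖ = T := by rw [hxdef, hydef]; exact norm_translate_sub_boxCentre H T
  have hxc : ‖x - boxCentre H‖ ≤ (H : ℝ) / 8 := by
    rw [hxdef, sub_self, norm_zero]; positivity
  have hyc : ‖y - boxCentre H‖ ≤ (H : ℝ) / 8 := by
    rw [hydef, norm_translate_sub_boxCentre]; linarith
  constructor
  · have h := hK H hH x y i j k l hij hkl hxc hyc (by rw [hxy]; exact hT3r)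
    rwa [hxy] at h
  · have h := hK H hH y x k l i j hkl hij hyc hxc (by rw [hyx]; exact hT3r)
    rwa [hyx] at h

/-- **Along the one-scale family**: for `0 < A < θ`, eventually in `β`, with `H = ⌈β^θ⌉`, `T = ⌈β^A⌉` and `K = K₁ + K₂` from
`abs_boxDirProjKernel_centre_pair_le`, every plane pair (both orders) has `|C_D| ≤ K·β^{−4A}`. -/
theorem abs_boxDirProjKernel_centre_pair_le_rpow {A θ : ℝ} (hA : 0 < A) (hAθ : A < θ) :
    ∃ K : ℝ, 0 ≤ K ∧ ∃ β₀ : ℝ, ∀ β : ℝ, β₀ ≤ β → ∀ (i j k l : Fin 4), i < j → k < l →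
      |boxDirProjKernel ⌈β ^ θ⌉₊ (boxCentre ⌈β ^ θ⌉₊, i, j) (boxCentre ⌈β ^ θ⌉₊ + Pi.single 0 (⌈β ^ A⌉₊ : ℤ), k, l)| ≤ K * β ^ (-(4 * A)) ∧
      |boxDirProjKernel ⌈β ^ θ⌉₊ (boxCentre ⌈β ^ θ⌉₊ + Pi.single 0 (⌈β ^ A⌉₊ : ℤ), k, l) (boxCentre ⌈β ^ θ⌉₊, i, j)| ≤ K * β ^ (-(4 * A)) := by
  obtain ⟨K₁, K₂, hK₁, hK₂, hK⟩ := abs_boxDirProjKernel_centre_pair_le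
  obtain ⟨β₁, hβ₁1, h16⟩ := exists_const_mul_rpow_le_rpow 16 hAθ
  obtain ⟨β₂, -, h3⟩ := exists_const_mul_rpow_le_rpow 3 hA
  obtain ⟨β₃, -, h32⟩ := exists_const_mul_rpow_le_rpow 32 (hA.trans hAθ)
  refine ⟨K₁ + K₂, by positivity, max β₁ (max β₂ β₃), fun β hβ i j k l hij hkl => ?_⟩
  have hb₁ : β₁ ≤ β := (le_max_left _ _).trans hβ
  have hb₂ : β₂ ≤ β := ((le_max_left _ _).trans (le_max_right _ _)).trans hβ
  have hb₃ : β₃ ≤ β := ((le_max_right _ _).trans (le_max_right _ _)).trans hβ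
  have hβ1 : 1 ≤ β := hβ₁1.trans hb₁
  have hβ0 : 0 < β := by linarith
  have hTA : β ^ A ≤ (⌈β ^ A⌉₊ : ℝ) := Nat.le_ceil _
  have hHθ : β ^ θ ≤ (⌈β ^ θ⌉₊ : ℝ) := Nat.le_ceil _
  have hT3r : (3 : ℝ) ≤ (⌈β ^ A⌉₊ : ℝ) := by
    have h := h3 β hb₂
    rw [Real.rpow_zero, mul_one] at h
    exact h.trans hTA
  have hT3 : 3 ≤ ⌈β ^ A⌉₊ := by exact_mod_cast hT3r
  have hH32 : (32 : ℝ) ≤ (⌈β ^ θ⌉₊ : ℝ) := by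
    have h := h32 β hb₃
    rw [Real.rpow_zero, mul_one] at h
    exact h.trans hHθ
  have h8r : (8 * ⌈β ^ A⌉₊ : ℝ) ≤ (⌈β ^ θ⌉₊ : ℝ) := by
    have h2 := natCeil_rpow_le_two_mul hβ1 hA.le
    have h := h16 β hb₁
    linarith
  have h8 : 8 * ⌈β ^ A⌉₊ ≤ ⌈β ^ θ⌉₊ := by exact_mod_cast h8r
  obtain ⟨e₁, e₂⟩ := hK _ hH32 _ hT3 h8 i j k l hij hkl
  -- `1/T⁴ ≤ β^{−4A}` and `1/H⁴ ≤ β^{−4A}`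
  have hβA : 0 < β ^ A := Real.rpow_pos_of_pos hβ0 _
  have h4 : β ^ (4 * A) = (β ^ A) ^ 4 := by
    rw [show (4 * A) = A * ((4 : ℕ) : ℝ) by push_cast; ring, Real.rpow_mul hβ0.le, Real.rpow_natCast]
  have hT4 : K₁ / (⌈β ^ A⌉₊ : ℝ) ^ 4 ≤ K₁ * β ^ (-(4 * A)) := by
    rw [Real.rpow_neg hβ0.le, ← div_eq_mul_inv, h4]
    exact div_le_div_of_nonneg_left hK₁ (by positivity) (pow_le_pow_left₀ hβA.le hTA 4)
  have hAθ' : β ^ A ≤ β ^ θ := Real.rpow_le_rpow_of_exponent_le hβ1 hAθ.le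
  have hH4 : K₂ / (⌈β ^ θ⌉₊ : ℝ) ^ 4 ≤ K₂ * β ^ (-(4 * A)) := by
    rw [Real.rpow_neg hβ0.le, ← div_eq_mul_inv, h4]
    exact div_le_div_of_nonneg_left hK₂ (by positivity) (pow_le_pow_left₀ hβA.le (hAθ'.trans hHθ) 4)
  have hsum : K₁ / (⌈β ^ A⌉₊ : ℝ) ^ 4 + K₂ / (⌈β ^ θ⌉₊ : ℝ) ^ 4 ≤ (K₁ + K₂) * β ^ (-(4 * A)) := by linarith
  exact ⟨e₁.trans hsum, e₂.trans hsum⟩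

end Summit.QuantumFields.YangMills.Theorems.WeakCouplingRates

end
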